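import Summits.BirchSwinnertonDyer.BirchSwinnertonDyer.Theorems.ErratumRoadFiveNonSurjCornerTwinMuAnSplitIndexAnyCarrier
import Summits.BirchSwinnertonDyer.BirchSwinnertonDyer.Theorems.ErratumRoadFiveNonSurjCornerTwinMuAnUnitValueBSD
import Literature.NumberTheory.EllipticCurves.PAdicHeightsProofs
import Summits.BirchSwinnertonDyer.BirchSwinnertonDyer.Theorems.PAdicOrderV2PAdicOrderThesisR2StubJetAssembly
import HarnessLib

/-!
# Route `ErratumRoadFive`, crux 19065 `NonSurjCorner`, child 19948 `NonSurjCornerTwinMuAn`: the SHAPE of the per-twin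
# analytic-μ certificate in BSD invariants — non-split: index `0` iff `p ∤ #Ш_an · ∏c`, else even `≥ 2`; split: odd `≥ 3`
# with NO Tate datum binder (cell `bsd-stepL`, seat `bsd-stepL-corner5-p2` g7; `--supports 19948 --as helper`)

The registered stubs `stub_twinMuAn_nonsplit` / `stub_twinMuAn_split` of 19948's line ask for SOME `n` with
`‖[Tⁿ](ϖ·L)‖_p = 1`. Writing `n₀` for the LEAST such index (the per-twin certificate that a modular-symbol kit must
exhibit), this file states WHERE `n₀` sits in terms of the twin's BSD invariants, assembling lane B's g6/g7 files and
corner-p1 g7's unit-value file: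

* §1 (non-split, `a_p = −1`): `[T⁰](ϖ·L) = 2ϖ[0]⁺_f = 2·#Ш_an·∏c/#tors²` (MTT §I.10 `ε(p) = 0`; p583299
  `varpi_mul_ratPlusSymbol_eq`, GZK by name), so `‖[T⁰]‖ = 1 ⟺ ord_p #Ш_an + ord_p ∏c = 0`
  (`norm_coeff_zero_C_mul_eq_one_iff_of_neg_one`; `#tors` prime to `p` by irreducibility, `‖2‖_p = 1`); on the corner
  `p ∣ ∏c(Wd) ⟺ Wd has a split multiplicative place` (g4 `CornerLocal.NonSurjTwin.dvd_tamagawaProduct_iff_exists_split`);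
* §2 the non-split certificate shape: **`n₀ = 0 ⟺ (ord_p #Ш_an = 0 ∧ no split place)`, otherwise `n₀` is EVEN and
  `≥ 2`** (parity law p587429) — `NonSurjTwin.firstUnitCoeff_nonsplit_shape`, `…find_nonsplit_shape` (Wuthrich Cor. 18);
* §3 the split certificate shape with the Tate datum binder DISCHARGED (`nonempty_tateParameterData_iff_holds`, Tate's
  theorem in the tree): **`n₀` is ODD and `≥ 3`** on every split corner twin with `p`-integral `#Ш_an`
  (`NonSurjTwin.three_le_find_of_split_noDatum`; p587950 without `Dq`).

So the per-twin BC5 kit for 19948 reads: non-split & carrier-free → the exact value `L(Wd,1)/Ω` (n₀ = 0 iff a `p`-unit);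
non-split with a carrier or `p ∣ #Ш_an` → OMS coefficient `[T²]` or a later EVEN one; split → `[T³]` or a later ODD one.
Data (this seat's kit j294260/j294262…; lane A CERT-TWINMUAN-5): n₀ ∈ {0} ∪ {2} ∪ {3,5} exactly along these three classes.
HONEST FRAMING: theorems only (no definition, no new named fact, no `sorry`); conditional BY NAME on GZK, Greenberg–Stevens,
modularity (`exists_isNewformOf`) and Wuthrich Cor. 18 where displayed, and on the per-twin numeric binder `shaAn Wd = q`
(`ord_p q ≥ 0` where stated); nothing closes (T7); BSD is proved for no class.
References: [MazurTateTeitelbaum1986Invent] §I.10, §I.15, §I.17–18; [GreenbergLNM1716] §4 (PDF p. 113); [Wuthrich2014] Cor. 18;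
[SilvermanATAEC1994] Thm. V.5.3, Cor. IV.9.2 (d); tree: p499490, p583299, p583928, p584834, p587429, p587950.
-/

set_option autoImplicit false
set_option linter.dupNamespace false

noncomputable section

open scoped Classical NumberField MatrixGroups ModularForm

/-! ### §1 The constant term at a non-split prime in BSD invariants -/

namespace Summit.BirchSwinnertonDyer.Rank1Residual.X11b.MuAnUnit

open CongruenceSubgroup PowerSeries WeierstrassCurve Literature.NumberTheory.EllipticCurves
  Literature.NumberTheory.EllipticCurves.ModularForms Literature.NumberTheory.EllipticCurves.Rank1Residual
  Summit.BirchSwinnertonDyer.Rank1Residual IsDedekindDomain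

variable {N : ℕ} [NeZero N] {f : CuspForm (Gamma0 N) 2} {p : ℕ} [Fact p.Prime]
  {Wd : WeierstrassCurve ℚ} [Wd.IsElliptic] [Wd.IsGloballyMinimal]

/-- **The constant term at a NON-split prime in BSD invariants**: for an X11a twin (`r_an = 0`, `E[p]` irreducible,
`p ≠ 2`), newform `f`, `ϖ·Ω = Ω⁺_f`, THE non-split function `L` (`IsMultPAdicLFunctionOf f p (−1) L`) and `shaAn Wd = q ≠ 0`:
`‖[T⁰](ϖ·L)‖_p = p^{−(ord_p q + ord_p ∏c(Wd))}` — `[T⁰] = 2ϖ[0]⁺_f` (MTT §I.10, `ε(p) = 0`, `α = −1`),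
`ϖ[0]⁺_f = q·∏c/#tors²` (GZK by name, `Reg = 1`), `‖2‖ = ‖#tors‖ = 1` (`WieferichJet.norm_two_eq_one`, reused). [cite: GreenbergLNM1716, §4 (PDF p. 113)]
[cite: MazurTateTeitelbaum1986Invent, §I.10] -/
theorem norm_coeff_zero_C_mul_of_neg_one_eq_zpow (hp2 : p ≠ 2) (hGZK : rank_eq_analyticRank_of_analyticRank_le_one)
    (hXa : ClassX11a Wd p) (hf : IsNewformOf Wd f) {ϖ : ℚ} (hϖ : (ϖ : ℝ) * Wd.realPeriodRat = plusPeriod f)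
    {L : PowerSeries ℚ_[p]} (hL : IsMultPAdicLFunctionOf f p (-1) L) {q : ℚ} (hq : shaAn Wd = (q : ℂ)) (hq0 : q ≠ 0) :
    ‖PowerSeries.coeff 0 (PowerSeries.C ((ϖ : ℚ) : ℚ_[p]) * L)‖ =
      ((p : ℚ) : ℝ) ^ (-(padicValRat p q + padicValNat p Wd.tamagawaProduct)) := by
  have htq : (Wd.torsionOrder : ℚ) ≠ 0 := by exact_mod_cast (Wd.torsionOrder_pos_holds).ne'
  have hcq : (Wd.tamagawaProduct : ℚ) ≠ 0 := by exact_mod_cast (Wd.tamagawaProduct_pos').ne'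
  have hid := varpi_mul_ratPlusSymbol_eq hGZK hXa.1 hf hϖ hq
  have hne : ϖ * ratPlusSymbol f 0 ≠ 0 := by rw [hid]; exact div_ne_zero (mul_ne_zero hq0 hcq) (pow_ne_zero 2 htq)
  have ht0 : padicValNat p Wd.torsionOrder = 0 := padicValNat_torsionOrder_eq_zero_of_irreducible Wd p hXa.2.2.2.1
  have hval : padicValRat p (ϖ * ratPlusSymbol f 0) = padicValRat p q + padicValNat p Wd.tamagawaProduct := by
    rw [hid, padicValRat.div (mul_ne_zero hq0 hcq) (pow_ne_zero 2 htq), padicValRat.mul hq0 hcq, padicValRat.pow,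
      show (Wd.tamagawaProduct : ℚ) = ((Wd.tamagawaProduct : ℕ) : ℚ) by norm_cast, padicValRat.of_nat,
      show (Wd.torsionOrder : ℚ) = ((Wd.torsionOrder : ℕ) : ℚ) by norm_cast, padicValRat.of_nat, ht0]
    simp
  rw [coeff_zero_C_mul_of_neg_one hL, show ((ϖ : ℚ) : ℚ_[p]) * (2 * (ratPlusSymbol f 0 : ℚ_[p])) =
      2 * (((ϖ * ratPlusSymbol f 0 : ℚ)) : ℚ_[p]) by push_cast; ring, norm_mul,
    Summit.BirchSwinnertonDyer.BirchSwinnertonDyer.Cruxes.PAdicOrderThesisR2.WieferichJet.norm_two_eq_one hp2, one_mul,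
    Padic.eq_padicNorm, padicNorm.eq_zpow_of_nonzero hne, hval]
  push_cast
  rfl

/-- **`‖[T⁰](ϖ·L)‖_p = 1 ⟺ ord_p #Ш_an(Wd) + ord_p ∏c(Wd) = 0`** at a non-split prime (same hypotheses).
[cite: MazurTateTeitelbaum1986Invent, §I.10] [cite: GreenbergLNM1716, §4 (PDF p. 113)] -/
theorem norm_coeff_zero_C_mul_eq_one_iff_of_neg_one (hp2 : p ≠ 2) (hGZK : rank_eq_analyticRank_of_analyticRank_le_one)
    (hXa : ClassX11a Wd p) (hf : IsNewformOf Wd f) {ϖ : ℚ} (hϖ : (ϖ : ℝ) * Wd.realPeriodRat = plusPeriod f)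
    {L : PowerSeries ℚ_[p]} (hL : IsMultPAdicLFunctionOf f p (-1) L) {q : ℚ} (hq : shaAn Wd = (q : ℂ)) (hq0 : q ≠ 0) :
    ‖PowerSeries.coeff 0 (PowerSeries.C ((ϖ : ℚ) : ℚ_[p]) * L)‖ = 1 ↔
      padicValRat p q + padicValNat p Wd.tamagawaProduct = 0 := by
  rw [norm_coeff_zero_C_mul_of_neg_one_eq_zpow hp2 hGZK hXa hf hϖ hL hq hq0]
  have hp1 : (1 : ℝ) < ((p : ℚ) : ℝ) := by exact_mod_cast (Fact.out : p.Prime).one_lt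
  rw [zpow_eq_one_iff_right₀ (by linarith) hp1.ne', neg_eq_zero]

/-- With `ord_p q ≥ 0`: **`‖[T⁰](ϖ·L)‖_p = 1 ⟺ (ord_p #Ш_an = 0 ∧ p ∤ ∏c(Wd))`** at a non-split prime.
[cite: MazurTateTeitelbaum1986Invent, §I.10] -/
theorem norm_coeff_zero_C_mul_eq_one_iff_of_neg_one_of_nonneg (hp2 : p ≠ 2)
    (hGZK : rank_eq_analyticRank_of_analyticRank_le_one) (hXa : ClassX11a Wd p) (hf : IsNewformOf Wd f) {ϖ : ℚ}
    (hϖ : (ϖ : ℝ) * Wd.realPeriodRat = plusPeriod f) {L : PowerSeries ℚ_[p]} (hL : IsMultPAdicLFunctionOf f p (-1) L)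
    {q : ℚ} (hq : shaAn Wd = (q : ℂ)) (hq0 : q ≠ 0) (hint : 0 ≤ padicValRat p q) :
    ‖PowerSeries.coeff 0 (PowerSeries.C ((ϖ : ℚ) : ℚ_[p]) * L)‖ = 1 ↔
      (padicValRat p q = 0 ∧ ¬ p ∣ Wd.tamagawaProduct) := by
  rw [norm_coeff_zero_C_mul_eq_one_iff_of_neg_one hp2 hGZK hXa hf hϖ hL hq hq0]
  have hc0 : Wd.tamagawaProduct ≠ 0 := (Wd.tamagawaProduct_pos').ne'
  constructor
  · intro h
    have hv : (padicValNat p Wd.tamagawaProduct : ℤ) = 0 := by exact_mod_cast (by omega : (padicValNat p Wd.tamagawaProduct : ℤ) = 0)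
    refine ⟨by omega, ?_⟩
    intro hd
    have := (padicValNat_dvd_iff_le hc0).mp (show p ^ 1 ∣ Wd.tamagawaProduct by rwa [pow_one])
    omega
  · rintro ⟨h0, hnd⟩
    rw [h0, padicValNat.eq_zero_of_not_dvd hnd]
    simp

end Summit.BirchSwinnertonDyer.Rank1Residual.X11b.MuAnUnit

/-! ### §2–§3 The certificate shape on the corner twins -/

namespace Summit.BirchSwinnertonDyer.BirchSwinnertonDyer.Theorems.TatePow

open CongruenceSubgroup PowerSeries WeierstrassCurve IsDedekindDomain Rat.HeightOneSpectrum
  Literature.NumberTheory.EllipticCurves Literature.NumberTheory.EllipticCurves.ModularForms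
  Literature.NumberTheory.EllipticCurves.Rank1Residual Summit.BirchSwinnertonDyer.Rank1Residual
  Summit.BirchSwinnertonDyer.Rank1Residual.X11b.MuAnUnit

variable {W : WeierstrassCurve ℚ} [W.IsElliptic] [W.IsGloballyMinimal] {p : ℕ} [Fact p.Prime]
  {N : ℕ} [NeZero N] {f : CuspForm (Gamma0 N) 2}

/-- **Non-split corner twin: the certificate shape.** Under the binders of `stub_twinMuAn_nonsplit` (19948) with
`shaAn Wd = q`, `ord_p q ≥ 0`, GZK and modularity by name, let `n` be the first index with `‖[Tⁿ](ϖ·L)‖ = 1` (earlier ones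
`< 1`). Then **`n = 0 ⟺ (ord_p #Ш_an(Wd) = 0 ∧ Wd has no split multiplicative place)`** (the unit-VALUE certificate of
p499490 ∕ p583299, now with its converse) **and otherwise `n` is even and `≥ 2`** (parity law p587429).
[cite: MazurTateTeitelbaum1986Invent, §I.10, §I.17 and §I.18] [cite: SilvermanATAEC1994, Cor. IV.9.2 (d)] -/
theorem NonSurjTwin.firstUnitCoeff_nonsplit_shape (hmod : exists_isNewformOf)
    (hGZK : rank_eq_analyticRank_of_analyticRank_le_one) (hXa : ClassX11a W p) (hnsj : ¬ Surj W p)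
    (h57 : p = 5 ∨ p = 7) (hns : ¬ W.HasSplitMultiplicativeReductionAtPrime p) (hf : IsNewformOf W f) {ϖ : ℚ}
    (hϖ : (ϖ : ℝ) * W.realPeriodRat = plusPeriod f) {L : PowerSeries ℚ_[p]} (hL : IsMultPAdicLFunctionOf f p (-1) L)
    {q : ℚ} (hq : shaAn W = (q : ℂ)) (hq0 : q ≠ 0) (hint : 0 ≤ padicValRat p q) {n : ℕ}
    (hsmall : ∀ j < n, ‖PowerSeries.coeff j (PowerSeries.C ((ϖ : ℚ) : ℚ_[p]) * L)‖ < 1)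
    (hn : ‖PowerSeries.coeff n (PowerSeries.C ((ϖ : ℚ) : ℚ_[p]) * L)‖ = 1) :
    (n = 0 ↔ (padicValRat p q = 0 ∧ ∀ v : HeightOneSpectrum (𝓞 ℚ), ¬ W.HasSplitMultiplicativeReductionAt v)) ∧
      (n ≠ 0 → 2 ≤ n ∧ Even n) := by
  have hp2 : p ≠ 2 := by rcases h57 with rfl | rfl <;> decide
  have hp5 : 5 ≤ p := by rcases h57 with rfl | rfl <;> norm_num
  have hiff := norm_coeff_zero_C_mul_eq_one_iff_of_neg_one_of_nonneg hp2 hGZK hXa hf hϖ hL hq hq0 hint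
  have hsplit_iff : ¬ p ∣ W.tamagawaProduct ↔ ∀ v : HeightOneSpectrum (𝓞 ℚ), ¬ W.HasSplitMultiplicativeReductionAt v := by
    rw [Summit.BirchSwinnertonDyer.BirchSwinnertonDyer.Theorems.CornerLocal.NonSurjTwin.dvd_tamagawaProduct_iff_exists_split
      W p hXa hnsj hp5, not_exists]
  constructor
  · constructor
    · intro h0
      subst h0
      have h := hiff.mp hn
      exact ⟨h.1, hsplit_iff.mp h.2⟩
    · rintro ⟨hv, hnos⟩
      by_contra hne
      have hlt := hsmall 0 (Nat.pos_of_ne_zero hne)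
      have heq := hiff.mpr ⟨hv, hsplit_iff.mpr hnos⟩
      rw [heq] at hlt
      exact lt_irrefl _ hlt
  · intro hne
    have hlt := hsmall 0 (Nat.pos_of_ne_zero hne)
    exact NonSurjTwin.two_le_firstUnitCoeff_of_nonsplit_of_nonunit_value hmod hXa hns hf hL _ hsmall hn hlt

/-- **Non-split corner twin, `Nat.find` form** (Wuthrich Cor. 18 by name for the integrality of `ϖ·L`): the least witness
`n₀` of `stub_twinMuAn_nonsplit`'s `∃ n` is `0` iff `ord_p #Ш_an(Wd) = 0 ∧` no split place, and otherwise even `≥ 2`.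
[cite: Wuthrich2014, Cor. 18 (p. 398)] [cite: MazurTateTeitelbaum1986Invent, §I.10, §I.17 and §I.18] -/
theorem NonSurjTwin.find_nonsplit_shape
    (hWu : Wuthrich2014.corollary18_padicLFunction_mem_iwasawaAlgebra_multiplicative) (hmod : exists_isNewformOf)
    (hGZK : rank_eq_analyticRank_of_analyticRank_le_one) (hXa : ClassX11a W p) (hnsj : ¬ Surj W p)
    (h57 : p = 5 ∨ p = 7) (hns : ¬ W.HasSplitMultiplicativeReductionAtPrime p) (hf : IsNewformOf W f) {ϖ : ℚ}
    (hϖ : (ϖ : ℝ) * W.realPeriodRat = plusPeriod f) {L : PowerSeries ℚ_[p]} (hL : IsMultPAdicLFunctionOf f p (-1) L)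
    {q : ℚ} (hq : shaAn W = (q : ℂ)) (hq0 : q ≠ 0) (hint : 0 ≤ padicValRat p q)
    (h : ∃ n : ℕ, ‖PowerSeries.coeff n (PowerSeries.C ((ϖ : ℚ) : ℚ_[p]) * L)‖ = 1) :
    (Nat.find h = 0 ↔ (padicValRat p q = 0 ∧ ∀ v : HeightOneSpectrum (𝓞 ℚ), ¬ W.HasSplitMultiplicativeReductionAt v)) ∧
      (Nat.find h ≠ 0 → 2 ≤ Nat.find h ∧ Even (Nat.find h)) := by
  obtain ⟨G, hG⟩ := (hWu W p hXa.2.1 hXa.2.2.1 hf ϖ hϖ).1 hns L hL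
  have hle := (exists_iwasawaToPowerSeries_eq_iff_norm_coeff_le_one _).mp ⟨G, hG⟩
  exact NonSurjTwin.firstUnitCoeff_nonsplit_shape hmod hGZK hXa hnsj h57 hns hf hϖ hL hq hq0 hint
    (NonSurjTwin.norm_coeff_lt_one_of_lt_find hle h) (Nat.find_spec h)

/-- **Split corner twin, `Nat.find` form, NO Tate datum binder**: the least witness of `stub_twinMuAn_split`'s `∃ n` is odd
and `≥ 3` — `NonSurjTwin.three_le_find_of_split_anyCarrier` (p587950) with `Dq` obtained from Tate's theorem
(`nonempty_tateParameterData_iff_holds`); binders = the stub's + {GZK, Greenberg–Stevens, Wuthrich Cor. 18, modularity} by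
name + `shaAn Wd = q` `p`-integral. [cite: SilvermanATAEC1994, Thm. V.5.3] [cite: MazurTateTeitelbaum1986Invent, §I.15, §I.17 and §I.18] -/
theorem NonSurjTwin.three_le_find_of_split_noDatum
    (hWu : Wuthrich2014.corollary18_padicLFunction_mem_iwasawaAlgebra_multiplicative) (hmod : exists_isNewformOf)
    (hGZK : rank_eq_analyticRank_of_analyticRank_le_one) (hGS : greenberg_stevens (W := W) (p := p))
    (hXa : ClassX11a W p) (hnsj : ¬ Surj W p) (h57 : p = 5 ∨ p = 7) (hsplit : W.HasSplitMultiplicativeReductionAtPrime p)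
    (hf : IsNewformOf W f) {ϖ : ℚ} (hϖ : (ϖ : ℝ) * W.realPeriodRat = plusPeriod f)
    {L : PowerSeries ℚ_[p]} (hL : IsMultPAdicLFunctionOf f p 1 L) {q : ℚ} (hq : shaAn W = (q : ℂ)) (hq0 : q ≠ 0)
    (hint : 0 ≤ padicValRat p q)
    (h : ∃ n : ℕ, ‖PowerSeries.coeff n (PowerSeries.C ((ϖ : ℚ) : ℚ_[p]) * L)‖ = 1) :
    3 ≤ Nat.find h ∧ Odd (Nat.find h) := by
  obtain ⟨Dq⟩ := (nonempty_tateParameterData_iff_holds (W := W) (p := p)).mpr hsplit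
  exact NonSurjTwin.three_le_find_of_split_anyCarrier hWu hmod hGZK hXa hnsj h57 hsplit hGS Dq hf hϖ hL hq hq0 hint h

/-- **Split corner twin, least-index form, NO Tate datum binder** (no Wuthrich needed): if `n` is the first index with
`‖[Tⁿ](ϖ·L)‖ = 1` (earlier ones `< 1`) then `3 ≤ n` and `n` is odd. [cite: SilvermanATAEC1994, Thm. V.5.3]
[cite: MazurTateTeitelbaum1986Invent, §I.15, §I.17 and §I.18] -/
theorem NonSurjTwin.three_le_firstUnitCoeff_of_split_noDatum (hmod : exists_isNewformOf)
    (hGZK : rank_eq_analyticRank_of_analyticRank_le_one) (hGS : greenberg_stevens (W := W) (p := p))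
    (hXa : ClassX11a W p) (hnsj : ¬ Surj W p) (h57 : p = 5 ∨ p = 7) (hsplit : W.HasSplitMultiplicativeReductionAtPrime p)
    (hf : IsNewformOf W f) {ϖ : ℚ} (hϖ : (ϖ : ℝ) * W.realPeriodRat = plusPeriod f)
    {L : PowerSeries ℚ_[p]} (hL : IsMultPAdicLFunctionOf f p 1 L) {q : ℚ} (hq : shaAn W = (q : ℂ)) (hq0 : q ≠ 0)
    (hint : 0 ≤ padicValRat p q) {n : ℕ}
    (hsmall : ∀ j < n, ‖PowerSeries.coeff j (PowerSeries.C ((ϖ : ℚ) : ℚ_[p]) * L)‖ < 1)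
    (hn : ‖PowerSeries.coeff n (PowerSeries.C ((ϖ : ℚ) : ℚ_[p]) * L)‖ = 1) : 3 ≤ n ∧ Odd n := by
  obtain ⟨Dq⟩ := (nonempty_tateParameterData_iff_holds (W := W) (p := p)).mpr hsplit
  exact NonSurjTwin.three_le_firstUnitCoeff_of_split_anyCarrier hmod hGZK hXa hnsj h57 hsplit hGS Dq hf hϖ hL hq hq0 hint
    hsmall hn

end Summit.BirchSwinnertonDyer.BirchSwinnertonDyer.Theorems.TatePow

end
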